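import Summits.CriticalPhenomena.PercolationContinuityZ3.Theorems.PercFiniteBoxLRORenormaliseFromLinearLROSpineCriterion

/-!
# Crux `PercFiniteBoxLRO.RenormaliseFromLinearLRO` (stmt-CriticalPhenomena-0857), line `registered` — anatomy of the
# residual: linear-scale LRO at `p_c` FORCES two disjoint spanning clusters in linear annuli at all large scales

The dense/spine machinery of reshapes 2–3 (`…SpineCriterion.lean`, p163218) read contrapositively inside a
hypothetical world with `LRO_lin(p_c)` (`ρ > 0`, `K ≥ 2`): since no spine is likely at `p_c`
(`stub_noSpineAtPc`), the second-moment hypothesis of `stub_denseMarkov` must FAIL at every local scale `s` and every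
large grid size `m` — the average in-`Λ(Kn)` connectivity of the grid pairs of `Λ(n)`, `n = (2s+1)m`, stays below
`(1 − 2η₀)θ_s²`, `η₀ = c₀/K` — while two far grid points are both in the infinite cluster with probability
`≥ θ_s² − 2(θ_s − θ)`.  A pair of points of `Λ(n)` both joined to infinity but not to each other inside `Λ(Kn)` gives two
DISTINCT clusters of the configuration restricted to `Λ(Kn)` joining `Λ(n)` to `∂ⁱⁿΛ(Kn)` — the box two-arms event of this
route's item r5 `CritBoxTwoArmsDecay` (stmt-CriticalPhenomena-0859) at LINEAR ratio `M = K·n`: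

* `stub_lroForcesLinearTwoArms` — `LRO_lin(p_c)` with `(ρ, K)`, `K ≥ 2` ⇒ there is `c > 0` (`= c₀θ(p_c)²/K`-sized) such
  that for all large `s` and, given `s`, all large `m`, the r5 event with `n = (2s+1)m`, `M = K·n` has
  `P_{p_c}`-probability `≥ c`.

So in the hypothetical LRO world linear annuli are NEVER crossed by a unique cluster w.h.p.; the crux is exactly the
statement that uniform `ρ`-connectivity cannot coexist with this at `p_c(ℤ³)`.  Lands `--supports stmt-CriticalPhenomena-0857`.
-/

noncomputable section

namespace Summit.CriticalPhenomena.PercolationContinuityZ3.Theorems.RenormaliseFromLinearLRO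

open Literature.Probability.Percolation Literature.Probability.LatticeModels
open MeasureTheory Filter Topology

/-! ## Percolating points reach the inner boundary of every box containing them -/

/-- A point of the finite box `Λ(M)` with an infinite open cluster is joined INSIDE `Λ(M)` to a vertex of the inner
vertex boundary of `Λ(M)` (first exit of a path to a cluster point outside the box; lattice configurations). -/
theorem twoArms_exists_openConnIn_innerBoundary {M : ℕ} {ω : BondConfig (Site 3)} (hω : ω ⊆ (zdGraph 3).edgeSet)
    {y : Site 3} (hy : y ∈ box 3 M) (hperc : ω ∈ percolatesAt y) :
    ∃ z ∈ innerBoundary (zdGraph 3) (box 3 M), ω ∈ openConnIn (↑(box 3 M) : Set (Site 3)) y z := by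
  have hinf : (openCluster ω y).Infinite := hperc
  obtain ⟨w, hw, hwM⟩ := hinf.exists_notMem_finset (box 3 M)
  have hpath : PathIn (openGraph ω) Set.univ y w := DCT16.pathIn_univ_of_reachable hw
  obtain ⟨a, b, ha, hb, -, hab, hpa⟩ := hpath.exit (R := (↑(box 3 M) : Set (Site 3))) (Finset.mem_coe.2 hy)
    (fun h => hwM (Finset.mem_coe.1 h))
  refine ⟨a, mem_innerBoundary_iff.2 ⟨Finset.mem_coe.1 ha, b, fun h => hb (Finset.mem_coe.2 h),
    DCT16.adj_of_openGraph_adj hω hab⟩, ?_⟩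
  exact DCT16.mem_openConnIn_of_pathIn (hpa.mono Set.inter_subset_left)

/-- A percolating point is locally large at every scale (lattice configurations). -/
theorem twoArms_armEvent_of_percolatesAt {s : ℕ} {ω : BondConfig (Site 3)} (hω : ω ⊆ (zdGraph 3).edgeSet)
    {y : Site 3} (hperc : ω ∈ percolatesAt y) : ω ∈ DCT16.armEvent y s := by
  have hinf : (openCluster ω y).Infinite := hperc
  obtain ⟨w, hw, hwM⟩ := hinf.exists_notMem_finset ((box 3 s).image (· + y))
  have hpath : PathIn (openGraph ω) Set.univ y w := DCT16.pathIn_univ_of_reachable hw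
  refine DCT16.armEvent_of_pathIn hω hpath (Or.inl fun h => hwM ?_)
  exact Finset.mem_image.2 ⟨w - y, h, sub_add_cancel w y⟩

/-! ## The two-arms event from two percolating points not joined inside the box -/

/-- Two points of `Λ(n) ⊆ Λ(M)` both percolating but NOT joined inside `Λ(M)` produce the box two-arms event of item r5
at radii `(n, M)` (lattice configurations). -/
theorem twoArms_of_percolates {n M : ℕ} (hnM : n ≤ M) {ω : BondConfig (Site 3)} (hω : ω ⊆ (zdGraph 3).edgeSet)
    {y y' : Site 3} (hy : y ∈ box 3 n) (hy' : y' ∈ box 3 n) (hp : ω ∈ percolatesAt y) (hp' : ω ∈ percolatesAt y')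
    (hnot : ω ∉ openConnIn (↑(box 3 M) : Set (Site 3)) y y') :
    ω ∈ {ω | ∃ x ∈ box 3 n, ∃ x' ∈ box 3 n, ∃ z ∈ innerBoundary (zdGraph 3) (box 3 M),
      ∃ z' ∈ innerBoundary (zdGraph 3) (box 3 M),
        ω ∈ openConnIn ↑(box 3 M) x z ∧ ω ∈ openConnIn ↑(box 3 M) x' z' ∧ ω ∉ openConnIn ↑(box 3 M) x x'} := by
  have hsub : box 3 n ⊆ box 3 M := fun x hx => by
    rw [mem_box] at hx ⊢; intro i; have := hx i; constructor <;> omega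
  obtain ⟨z, hz, hyz⟩ := twoArms_exists_openConnIn_innerBoundary hω (hsub hy) hp
  obtain ⟨z', hz', hyz'⟩ := twoArms_exists_openConnIn_innerBoundary hω (hsub hy') hp'
  exact ⟨y, hy, y', hy', z, hz, z', hz', hyz, hyz', hnot⟩

/-! ## Probability of two far points both percolating -/

/-- For two grid-far points, `P(both percolate) ≥ θ_s² − 2(θ_s − θ)`: both are locally large with probability exactly
`θ_s²` (independence of far one-arm events), and "locally large but not percolating" has probability `θ_s − θ` for each. -/
theorem twoArms_real_inter_percolatesAt_ge (p : unitInterval) {s : ℕ} {y y' : Site 3}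
    (hfar : ∃ i : Fin 3, ((2 * s + 1 : ℕ) : ℤ) ≤ |y i - y' i|) :
    (bondPercolation (zdGraph 3) p).real (siteToBoundary 3 s) ^ 2 -
        2 * ((bondPercolation (zdGraph 3) p).real (siteToBoundary 3 s) - theta (zdGraph 3) 0 p) ≤
      (bondPercolation (zdGraph 3) p).real (percolatesAt y ∩ percolatesAt y') := by
  set P := bondPercolation (zdGraph 3) p with hP
  have hI : ∀ x : Site 3, P.real (percolatesAt x) = theta (zdGraph 3) 0 p := fun x => theta_zdGraph_eq_theta_zero p x
  have hL : ∀ x : Site 3, P.real (DCT16.armEvent x s) = P.real (siteToBoundary 3 s) := fun x => DCT16.real_armEvent p x s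
  -- a.s. inclusions percolatesAt x ⊆ armEvent x s
  have hdiff : ∀ x : Site 3, P.real (DCT16.armEvent x s \ percolatesAt x) =
      P.real (siteToBoundary 3 s) - theta (zdGraph 3) 0 p := by
    intro x
    have hae : P.real (percolatesAt x \ DCT16.armEvent x s) = 0 := by
      refine le_antisymm ?_ measureReal_nonneg
      have : P.real (percolatesAt x \ DCT16.armEvent x s) ≤ P.real (∅ : Set (BondConfig (Site 3))) :=
        DCT16.real_mono_of_forall_subset_edgeSet (zdGraph 3) p fun ω hω h =>
          absurd (twoArms_armEvent_of_percolatesAt hω h.1) h.2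
      simpa using this
    have h1 : P.real (DCT16.armEvent x s \ percolatesAt x) + P.real (DCT16.armEvent x s ∩ percolatesAt x) =
        P.real (DCT16.armEvent x s) := measureReal_sdiff_add_inter (measurableSet_percolatesAt_holds x)
    have h2 : P.real (percolatesAt x \ DCT16.armEvent x s) + P.real (percolatesAt x ∩ DCT16.armEvent x s) =
        P.real (percolatesAt x) := measureReal_sdiff_add_inter (measurableSet_armEvent x s)
    rw [Set.inter_comm] at h2
    linarith [hI x, hL x]
  -- (L ∩ L') \ ((L \ I) ∪ (L' \ I')) ⊆ I ∩ I'
  have hincl : (DCT16.armEvent y s ∩ DCT16.armEvent y' s) \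
      ((DCT16.armEvent y s \ percolatesAt y) ∪ (DCT16.armEvent y' s \ percolatesAt y')) ⊆
      percolatesAt y ∩ percolatesAt y' := by
    intro ω hω
    simp only [Set.mem_sdiff, Set.mem_inter_iff, Set.mem_union, not_or, not_and, not_not] at hω
    exact ⟨hω.2.1 hω.1.1, hω.2.2 hω.1.2⟩
  have hLL : P.real (DCT16.armEvent y s ∩ DCT16.armEvent y' s) = P.real (siteToBoundary 3 s) ^ 2 :=
    armEvent_real_inter p hfar
  calc P.real (siteToBoundary 3 s) ^ 2 - 2 * (P.real (siteToBoundary 3 s) - theta (zdGraph 3) 0 p)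
      = P.real (DCT16.armEvent y s ∩ DCT16.armEvent y' s) -
          (P.real (DCT16.armEvent y s \ percolatesAt y) + P.real (DCT16.armEvent y' s \ percolatesAt y')) := by
        rw [hLL, hdiff y, hdiff y']; ring
    _ ≤ P.real (DCT16.armEvent y s ∩ DCT16.armEvent y' s) -
          P.real ((DCT16.armEvent y s \ percolatesAt y) ∪ (DCT16.armEvent y' s \ percolatesAt y')) := by
        linarith [measureReal_union_le (μ := P) (DCT16.armEvent y s \ percolatesAt y)
          (DCT16.armEvent y' s \ percolatesAt y')]
    _ ≤ P.real ((DCT16.armEvent y s ∩ DCT16.armEvent y' s) \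
          ((DCT16.armEvent y s \ percolatesAt y) ∪ (DCT16.armEvent y' s \ percolatesAt y'))) :=
        le_measureReal_sdiff
    _ ≤ P.real (percolatesAt y ∩ percolatesAt y') := measureReal_mono hincl (measure_ne_top _ _)


/-! ## Averaging over the grid pairs -/

/-- **The two-arms probability against the pair-connectivity deficit.**  For the core grid `G` (`g` points) of `Λ(n)`,
`n = (2s+1)m`, and `M = K·n` (`K ≥ 1`):
`g(g−1)·P(two-arms(n, M)) ≥ g(g−1)·(θ_s² − 2(θ_s − θ)) − Σ_{y,y' ∈ G} P(y ↔ y' inside Λ(M))`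
(each ordered pair of DISTINCT grid points contributes `P(both percolate) − P(joined inside Λ(M)) ≤ P(two-arms)`). -/
theorem twoArms_real_mul_ge (p : unitInterval) (K s m : ℕ) (hK : 1 ≤ K) :
    ((coreGrid s m).card : ℝ) * ((coreGrid s m).card - 1) *
          ((bondPercolation (zdGraph 3) p).real (siteToBoundary 3 s) ^ 2 -
            2 * ((bondPercolation (zdGraph 3) p).real (siteToBoundary 3 s) - theta (zdGraph 3) 0 p)) -
        ∑ y ∈ coreGrid s m, ∑ y' ∈ coreGrid s m,
          (bondPercolation (zdGraph 3) p).real (openConnIn ↑(box 3 (K * ((2 * s + 1) * m))) y y') ≤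
      ((coreGrid s m).card : ℝ) * ((coreGrid s m).card - 1) *
        (bondPercolation (zdGraph 3) p).real {ω | ∃ x ∈ box 3 ((2 * s + 1) * m), ∃ x' ∈ box 3 ((2 * s + 1) * m),
          ∃ z ∈ innerBoundary (zdGraph 3) (box 3 (K * ((2 * s + 1) * m))),
            ∃ z' ∈ innerBoundary (zdGraph 3) (box 3 (K * ((2 * s + 1) * m))),
              ω ∈ openConnIn ↑(box 3 (K * ((2 * s + 1) * m))) x z ∧
                ω ∈ openConnIn ↑(box 3 (K * ((2 * s + 1) * m))) x' z' ∧
                  ω ∉ openConnIn ↑(box 3 (K * ((2 * s + 1) * m))) x x'} := by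
  classical
  set P := bondPercolation (zdGraph 3) p with hP
  set G := coreGrid s m with hG
  set n : ℕ := (2 * s + 1) * m with hn
  set M : ℕ := K * n with hM
  set T : Set (BondConfig (Site 3)) := {ω | ∃ x ∈ box 3 n, ∃ x' ∈ box 3 n,
      ∃ z ∈ innerBoundary (zdGraph 3) (box 3 M), ∃ z' ∈ innerBoundary (zdGraph 3) (box 3 M),
        ω ∈ openConnIn ↑(box 3 M) x z ∧ ω ∈ openConnIn ↑(box 3 M) x' z' ∧ ω ∉ openConnIn ↑(box 3 M) x x'} with hT
  set a : ℝ := P.real (siteToBoundary 3 s) ^ 2 - 2 * (P.real (siteToBoundary 3 s) - theta (zdGraph 3) 0 p) with ha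
  have hnM : n ≤ M := by rw [hM]; exact Nat.le_mul_of_pos_left n hK
  -- each ordered pair of distinct grid points
  have hpair : ∀ q ∈ G.offDiag, a - P.real (openConnIn (↑(box 3 M) : Set (Site 3)) q.1 q.2) ≤ P.real T := by
    intro q hq
    obtain ⟨hy, hy', hne⟩ := Finset.mem_offDiag.1 hq
    have hfar : ∃ i : Fin 3, ((2 * s + 1 : ℕ) : ℤ) ≤ |q.1 i - q.2 i| := by
      obtain ⟨z, -, hz⟩ := mem_coreGrid.1 hy
      obtain ⟨z', -, hz'⟩ := mem_coreGrid.1 hy'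
      rw [← hz, ← hz'] at hne ⊢
      exact exists_le_abs_sub_of_ne hne
    have h1 : a ≤ P.real (percolatesAt q.1 ∩ percolatesAt q.2) := twoArms_real_inter_percolatesAt_ge p hfar
    have h2 : P.real (percolatesAt q.1 ∩ percolatesAt q.2) - P.real (openConnIn (↑(box 3 M) : Set (Site 3)) q.1 q.2)
        ≤ P.real ((percolatesAt q.1 ∩ percolatesAt q.2) \ openConnIn (↑(box 3 M) : Set (Site 3)) q.1 q.2) :=
      le_measureReal_sdiff
    have h3 : P.real ((percolatesAt q.1 ∩ percolatesAt q.2) \ openConnIn (↑(box 3 M) : Set (Site 3)) q.1 q.2) ≤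
        P.real T :=
      DCT16.real_mono_of_forall_subset_edgeSet (zdGraph 3) p fun ω hω h =>
        twoArms_of_percolates hnM hω (coreGrid_subset_box s m hy) (coreGrid_subset_box s m hy') h.1.1 h.1.2 h.2
    linarith
  -- sum over the g(g-1) ordered pairs
  have hsum := Finset.sum_le_sum hpair
  rw [Finset.sum_const, nsmul_eq_mul, Finset.sum_sub_distrib, Finset.sum_const, nsmul_eq_mul,
    Finset.offDiag_card] at hsum
  have hcard : ((G.card * G.card - G.card : ℕ) : ℝ) = (G.card : ℝ) * (G.card - 1) := by
    rw [Nat.cast_sub (Nat.le_mul_self _)]; push_cast; ring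
  rw [hcard] at hsum
  -- the off-diagonal connection sum is at most the full double sum
  have hoff : ∑ q ∈ G.offDiag, P.real (openConnIn (↑(box 3 M) : Set (Site 3)) q.1 q.2) ≤
      ∑ y ∈ G, ∑ y' ∈ G, P.real (openConnIn (↑(box 3 M) : Set (Site 3)) y y') := by
    rw [← Finset.sum_product']
    exact Finset.sum_le_sum_of_subset_of_nonneg
      (fun q hq => Finset.mem_product.2 ⟨(Finset.mem_offDiag.1 hq).1, (Finset.mem_offDiag.1 hq).2.1⟩)
      (fun _ _ _ => measureReal_nonneg)
  linarith

/-! ## The contrapositive of the spine machinery at `p_c` -/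

/-- **At `p_c` the second-moment hypothesis fails at every large grid size.**  With `δ₀` of `stub_noSpineAtPc` and
`η₀ := δ₀/2000/K` (`K ≥ 2`), for every `s` with `θ_s > 0` and every `m ≥ 1` with
`(4K+2)·200/(θ_s² m³) < δ₀/2`: `Σ_{y,y' ∈ G} P_{p_c}(y ↔ y' inside Λ(Kn)) < (1 − 2η₀)·θ_s²·g²` (otherwise
`stub_denseMarkov` + `stub_spineFailure` make the spine `spineBox K s m K` likelier than `1 − δ₀`). -/
theorem pairSum_lt_criticalProbI {δ₀ : ℝ} (hδ : 0 < δ₀)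
    (hle : ∀ (K L : ℕ), 2 ≤ K → K ≤ L → ∀ s m : ℕ, 1 ≤ m →
      (bondPercolation (zdGraph 3) (criticalProbI 3)).real (spineBox K s m L) ≤ 1 - δ₀)
    {K s m : ℕ} (hK : 2 ≤ K) (hm : 1 ≤ m)
    (hθs : 0 < (bondPercolation (zdGraph 3) (criticalProbI 3)).real (siteToBoundary 3 s))
    (hmlarge : (4 * (K : ℝ) + 2) *
        (200 / ((bondPercolation (zdGraph 3) (criticalProbI 3)).real (siteToBoundary 3 s) ^ 2 * (m : ℝ) ^ 3)) < δ₀ / 2) :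
    ∑ y ∈ coreGrid s m, ∑ y' ∈ coreGrid s m,
        (bondPercolation (zdGraph 3) (criticalProbI 3)).real (openConnIn ↑(box 3 (K * ((2 * s + 1) * m))) y y') <
      (1 - 2 * (δ₀ / 2000 / K)) * (bondPercolation (zdGraph 3) (criticalProbI 3)).real (siteToBoundary 3 s) ^ 2 *
        ((coreGrid s m).card : ℝ) ^ 2 := by
  set P := bondPercolation (zdGraph 3) (criticalProbI 3) with hP
  set θs : ℝ := P.real (siteToBoundary 3 s) with hθsdef
  set η₀ : ℝ := δ₀ / 2000 / K with hη₀
  by_contra hge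
  have hpairs : (1 - 2 * η₀) * θs ^ 2 * ((coreGrid s m).card : ℝ) ^ 2 ≤
      ∑ y ∈ coreGrid s m, ∑ y' ∈ coreGrid s m, P.real (openConnIn ↑(box 3 (K * ((2 * s + 1) * m))) y y') :=
    not_lt.1 hge
  have hMarkov := stub_denseMarkov (criticalProbI 3) K s m (2 * η₀) (by omega) hm hθs hpairs
  have hSpine : P.real (spineBox K s m K)ᶜ ≤ (4 * K + 2) * P.real (denseBox K s m)ᶜ :=
    stub_spineFailure (criticalProbI 3) K s m K
  have hK42 : (0 : ℝ) ≤ 4 * K + 2 := by positivity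
  have hK0 : (0 : ℝ) < K := by exact_mod_cast (lt_of_lt_of_le (by norm_num) hK : 0 < K)
  have hcompl : P.real (spineBox K s m K)ᶜ < δ₀ := by
    have h1 : P.real (spineBox K s m K)ᶜ ≤ (4 * (K : ℝ) + 2) * (48 * (2 * η₀) + 200 / (θs ^ 2 * (m : ℝ) ^ 3)) :=
      hSpine.trans (mul_le_mul_of_nonneg_left hMarkov hK42)
    have hK2 : (2 : ℝ) ≤ K := by exact_mod_cast hK
    have h2 : (4 * (K : ℝ) + 2) * (48 * (2 * η₀)) ≤ 6 * K * (96 * η₀) := by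
      have : 0 ≤ η₀ := by positivity
      nlinarith
    have h3 : 6 * (K : ℝ) * (96 * η₀) = 576 * (δ₀ / 2000) := by
      rw [hη₀]; field_simp; ring
    nlinarith [h1, h2, h3, hmlarge]
  have hmeas : MeasurableSet (spineBox K s m K) := measurableSet_spineBox hK hm K
  have hdense : 1 - δ₀ < P.real (spineBox K s m K) := by
    have h1 : P.real (spineBox K s m K) + P.real (spineBox K s m K)ᶜ = 1 := by
      rw [measureReal_add_measureReal_compl hmeas, probReal_univ]
    linarith
  exact absurd (hle K K hK le_rfl s m hm) (not_le.2 hdense)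

/-! ## The registered sub-goal -/

/-- **Registered sub-goal `stub_lroForcesLinearTwoArms` of crux stmt-CriticalPhenomena-0857 — linear-scale LRO at `p_c`
forces two-arms in linear annuli at all large scales.**  If `LRO_lin(p_c)` holds with constants `(ρ, K)`, `K ≥ 2`, then
there is `c > 0` such that for all large local scales `s` and, given `s`, all large grid sizes `m`, the box two-arms
event of item r5 `CritBoxTwoArmsDecay` at radii `n = (2s+1)m`, `M = K·n` — two points of `Λ(n)` joined inside `Λ(M)` to
its inner boundary but not to each other — has `P_{p_c}`-probability `≥ c`.  Proof: `c := η₀·θ(p_c)²`,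
`η₀ = δ₀/2000/K`; `pairSum_lt_criticalProbI` and `twoArms_real_mul_ge` give
`P(two-arms) ≥ 2η₀θ_s² − 2(θ_s − θ) − 2(1 − 2η₀)θ_s²/(g − 1)`-type bounds, and `θ_s ↓ θ`, `g → ∞`. -/
theorem stub_lroForcesLinearTwoArms :
    ∀ (ρ : ℝ) (K : ℕ), 0 < ρ → 2 ≤ K →
      (∀ n : ℕ, 1 ≤ n → ∀ x ∈ box 3 n, ∀ y ∈ box 3 n,
        ρ ≤ (bondPercolation (zdGraph 3) (criticalProbI 3)).real (openConnIn ↑(box 3 (K * n)) x y)) →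
      ∃ c : ℝ, 0 < c ∧ ∃ s₀ : ℕ, ∀ s : ℕ, s₀ ≤ s → ∃ m₀ : ℕ, ∀ m : ℕ, m₀ ≤ m →
        c ≤ (bondPercolation (zdGraph 3) (criticalProbI 3)).real
          {ω | ∃ x ∈ box 3 ((2 * s + 1) * m), ∃ x' ∈ box 3 ((2 * s + 1) * m),
            ∃ z ∈ innerBoundary (zdGraph 3) (box 3 (K * ((2 * s + 1) * m))),
              ∃ z' ∈ innerBoundary (zdGraph 3) (box 3 (K * ((2 * s + 1) * m))),
                ω ∈ openConnIn ↑(box 3 (K * ((2 * s + 1) * m))) x z ∧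
                  ω ∈ openConnIn ↑(box 3 (K * ((2 * s + 1) * m))) x' z' ∧
                    ω ∉ openConnIn ↑(box 3 (K * ((2 * s + 1) * m))) x x'} := by
  intro ρ K hρ hK hLRO
  obtain ⟨δ₀, hδ, hle⟩ := stub_noSpineAtPc
  set P := bondPercolation (zdGraph 3) (criticalProbI 3) with hP
  set θ : ℝ := theta (zdGraph 3) 0 (criticalProbI 3) with hθdef
  have hθρ : ρ ≤ θ := le_theta_of_linearLRO (criticalProbI 3) hLRO
  have hθ : 0 < θ := hρ.trans_le hθρ
  have hK0 : (0 : ℝ) < K := by exact_mod_cast (lt_of_lt_of_le (by norm_num) hK : 0 < K)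
  set η₀ : ℝ := δ₀ / 2000 / K with hη₀
  have hη₀pos : 0 < η₀ := by positivity
  refine ⟨η₀ * θ ^ 2, by positivity, ?_⟩
  -- s₀: θ_s - θ ≤ η₀ θ² / 4 beyond s₀
  have hlim := tendsto_real_siteToBoundary (d := 3) (criticalProbI 3)
  have hε : 0 < η₀ * θ ^ 2 / 4 := by positivity
  obtain ⟨s₀, hs₀⟩ := (Metric.tendsto_atTop.1 hlim) (η₀ * θ ^ 2 / 4) hε
  refine ⟨s₀, fun s hs => ?_⟩
  set θs : ℝ := P.real (siteToBoundary 3 s) with hθs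
  have hθs_ge : θ ≤ θs := DCT16.theta_le_real_siteToBoundary (criticalProbI 3) s
  have hθs_pos : 0 < θs := hθ.trans_le hθs_ge
  have hθs1 : θs ≤ 1 := measureReal_le_one
  have hclose : θs - θ ≤ η₀ * θ ^ 2 / 4 := by
    have h := hs₀ s hs
    rw [Real.dist_eq, abs_lt] at h
    linarith [h.2]
  -- m₀: the Markov remainder and 2/g are small
  have ht1 : Tendsto (fun m : ℕ => (4 * (K : ℝ) + 2) * (200 / (θs ^ 2 * (m : ℝ) ^ 3))) atTop (𝓝 0) := by
    have h3 : Tendsto (fun m : ℕ => θs ^ 2 * (m : ℝ) ^ 3) atTop atTop :=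
      Tendsto.const_mul_atTop (by positivity)
        ((tendsto_pow_atTop (by norm_num : (3 : ℕ) ≠ 0)).comp (tendsto_natCast_atTop_atTop (R := ℝ)))
    have h4 : Tendsto (fun m : ℕ => (200 : ℝ) / (θs ^ 2 * (m : ℝ) ^ 3)) atTop (𝓝 0) :=
      tendsto_const_nhds.div_atTop h3
    simpa using h4.const_mul (4 * (K : ℝ) + 2)
  have ht2 : Tendsto (fun m : ℕ => (4 : ℝ) / ((coreGrid s m).card : ℝ)) atTop (𝓝 0) := by
    have hg : Tendsto (fun m : ℕ => ((coreGrid s m).card : ℝ)) atTop atTop := by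
      have : (fun m : ℕ => ((coreGrid s m).card : ℝ)) = fun m : ℕ => (2 * (m : ℝ) + 1) ^ 3 := by
        funext m; rw [card_coreGrid]; push_cast; ring
      rw [this]
      refine (tendsto_pow_atTop (by norm_num : (3 : ℕ) ≠ 0)).comp ?_
      exact tendsto_atTop_add_const_right _ 1 (Tendsto.const_mul_atTop (by norm_num)
        (tendsto_natCast_atTop_atTop (R := ℝ)))
    exact tendsto_const_nhds.div_atTop hg
  obtain ⟨m₀, hm₀⟩ := (((ht1.eventually (gt_mem_nhds (half_pos hδ))).and
    (ht2.eventually (gt_mem_nhds hε))).and (eventually_ge_atTop 1)).exists_forall_of_atTop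
  refine ⟨m₀, fun m hm => ?_⟩
  obtain ⟨⟨hm1, hm2⟩, hm3⟩ := hm₀ m hm
  set g : ℝ := ((coreGrid s m).card : ℝ) with hg
  have hg27 : (27 : ℝ) ≤ g := by
    rw [hg, card_coreGrid]; push_cast
    have : (1 : ℝ) ≤ m := by exact_mod_cast hm3
    nlinarith [pow_le_pow_left₀ (by norm_num : (0:ℝ) ≤ 3) (by linarith : (3 : ℝ) ≤ 2 * m + 1) 3]
  have hgpos : 0 < g := by linarith
  have hg1 : 0 < g - 1 := by linarith
  -- the pair sum is small (spine contrapositive) and the two-arms bound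
  have hsmall := pairSum_lt_criticalProbI hδ hle hK hm3 hθs_pos hm1
  have hbig := twoArms_real_mul_ge (criticalProbI 3) K s m (by omega)
  set T := P.real {ω | ∃ x ∈ box 3 ((2 * s + 1) * m), ∃ x' ∈ box 3 ((2 * s + 1) * m),
      ∃ z ∈ innerBoundary (zdGraph 3) (box 3 (K * ((2 * s + 1) * m))),
        ∃ z' ∈ innerBoundary (zdGraph 3) (box 3 (K * ((2 * s + 1) * m))),
          ω ∈ openConnIn ↑(box 3 (K * ((2 * s + 1) * m))) x z ∧
            ω ∈ openConnIn ↑(box 3 (K * ((2 * s + 1) * m))) x' z' ∧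
              ω ∉ openConnIn ↑(box 3 (K * ((2 * s + 1) * m))) x x'} with hT
  -- g(g-1) T ≥ g(g-1)(θs² - 2(θs-θ)) - (1-2η₀) θs² g²
  have hkey : g * (g - 1) * (θs ^ 2 - 2 * (θs - θ)) - (1 - 2 * η₀) * θs ^ 2 * g ^ 2 ≤ g * (g - 1) * T := by
    linarith [hbig, hsmall]
  -- divide: T ≥ θs²(1 - (1-2η₀) g/(g-1)) - 2(θs - θ) ≥ 2η₀θs² - (1-2η₀)θs²/(g-1) - 2(θs-θ)
  have hT0 : 2 * η₀ * θs ^ 2 - θs ^ 2 / (g - 1) - 2 * (θs - θ) ≤ T := by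
    have e : g * (g - 1) * (θs ^ 2 - 2 * (θs - θ)) - (1 - 2 * η₀) * θs ^ 2 * g ^ 2 =
        g * (g - 1) * (2 * η₀ * θs ^ 2 - 2 * (θs - θ)) - (1 - 2 * η₀) * θs ^ 2 * g := by ring
    rw [e] at hkey
    have h1 : g * (g - 1) * (2 * η₀ * θs ^ 2 - 2 * (θs - θ)) - θs ^ 2 * g ≤ g * (g - 1) * T := by
      have : 0 ≤ 2 * η₀ * θs ^ 2 * g := by positivity
      nlinarith [hkey]
    have h2 : g * (g - 1) * (2 * η₀ * θs ^ 2 - θs ^ 2 / (g - 1) - 2 * (θs - θ)) =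
        g * (g - 1) * (2 * η₀ * θs ^ 2 - 2 * (θs - θ)) - θs ^ 2 * g := by
      field_simp
      ring
    have h3 : g * (g - 1) * (2 * η₀ * θs ^ 2 - θs ^ 2 / (g - 1) - 2 * (θs - θ)) ≤ g * (g - 1) * T := by
      rw [h2]; exact h1
    exact le_of_mul_le_mul_left h3 (mul_pos hgpos hg1)
  have hdiv : θs ^ 2 / (g - 1) ≤ η₀ * θ ^ 2 / 4 := by
    have h1 : θs ^ 2 / (g - 1) ≤ 1 / (g - 1) := by
      apply div_le_div_of_nonneg_right _ hg1.le
      nlinarith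
    have h2 : (1 : ℝ) / (g - 1) ≤ 4 / g := by
      rw [div_le_div_iff₀ hg1 hgpos]; linarith
    linarith [hm2.le]
  have hθs2 : θ ^ 2 ≤ θs ^ 2 := pow_le_pow_left₀ hθ.le hθs_ge 2
  nlinarith [hT0, hdiv, hclose, hθs2, hη₀pos]

end Summit.CriticalPhenomena.PercolationContinuityZ3.Theorems.RenormaliseFromLinearLRO

end
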